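import Summits.ResolutionOfSingularities.ResolutionOfSingularities.Theorems.MarkedTransferCampaignW13RFlatScaledTaylor
import Summits.ResolutionOfSingularities.ResolutionOfSingularities.Theorems.MarkedTransferCampaignW13RFlatCanonicalPosAllP
import Mathlib.Algebra.CharP.Lemmas
import Mathlib.Algebra.Ring.GeomSum
import HarnessLib

/-!
# [OURS · L1 W1.3] Surfaces, every characteristic (part 1/2): the family `g_p = u^p + (x³L^{p−2})^p + L^{p−1}(L^p+x^{2p+1})^{p−1}`,
# its arc, and `u^p ∉ ℘_alg(((g_p), p), 1)` for every prime `p` (seat res-L1-s13-pv-1, g3)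

LADDER-RESOLUTION rung L (rescue), cell `res-hironaka`, RESCUE-SEED slot W1.3 (architecture bypass, reading R-flat), F7′ row 1.
Part 1 of the uniform-in-`p` SURFACE refutation of o2's content Prop `Campaign.CampaignW13RFlatCanonicalPos` (p483384); part 2
(`MarkedTransferCampaignW13RFlatCanonicalPosSurfaceAllP.lean`) proves that the datum is canonical and states the headline
`¬ CampaignW13RFlatCanonicalPos p K (2 : Fin 3)`. p503083 (`p = 2`, surface S) and p508341 (every `p`, FOUR variables) left
open whether the failure occurs for SURFACES in odd characteristic (kit j271405: `p = 3` witnesses of degree 16, computed only).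
THE FAMILY, in the census chart `MvPolynomial (Fin 3) K` (`X 0 = x`, `X 1 = y`, `X 2 = u`), exponent parameter `k`, `p = k+2`,
`L := y − x`:  `F := L^p + x^{2p+1}`,  `M := x³·L^{p−2}`,  `ε_p := M^p + L^{p−1}·F^{p−1}`,  `g_p := u^p + ε_p`
(`ord₀ ε_p = p² − 1 > p`; at `p = 2` this is S of p503083, see part 2 `surfAllP_zero_eq_S`).

* THE ARC `γ(s) = (s^p, s^p − s^{2p+1}, −(s^{3p}(−s^{2p+1})^{p−2}))` lies ON `g_p = 0` (on the cusp `L^p = −x^{2p+1}` the term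
  `L^{p−1}F^{p−1}` vanishes and `u = −M`); along it every Hasse derivative `D^{(α)}g_p`, `1 ≤ |α| ≤ p−1`, vanishes identically
  EXCEPT `D_x^{(p−1)}`, of `s`-order `(p−1)(2p²+2p+1) = (2p³−2p+1) + (p−2)`, while `u^p∘γ = ±s^{2p(p²−1)}`. With
  `θ := s^{2p(p²−1)+1}` this is certified for all `α` at once in the SCALED-TAYLOR form of p506602's arc criterion (p512821
  `W13.not_mem_pAlgPiece_one_of_scaled_taylor`): `C(θ^p) ∣ g_p(γ + θ·v)` in `K[s][v₀,v₁,v₂]`, an identity valid in every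
  commutative ring of characteristic `p` (`surfAllP_ring_dvd`: freshman's dream for `(u+θv₂)^p` and `M(γ+θv)^p`; binomial
  remainder for `(ξ+θv₀)^{2p+1}` with `2p+1 ≡ 1`; first-order expansions of the two `(p−1)`-st powers; the one surviving term
  `θ^{p−1}λ^{p−1}ξ^{2p(p−1)}v₀^{p−1}` is `θ^p·(±s^{p−2})v₀^{p−1}` — `surfAllP_theta`).
* Hence **`u^p ∉ ℘_alg(((g_p), p), 1)`** for every prime `p` and field `K` of characteristic `p` (`surfAllP_tail_pow_not_mem`, bound
  algebraic `℘` of row 003 U17_2; stalk form `surfAllP_mul_tail_pow_not_mem`: `s·u^p ∉ ℘` for `s(0) ≠ 0`).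

How it was found: kit j271405's `p = 3` witness #1 (22 monomials, degree 16, arc `(s³, s³+2s⁷)`) reads in the coordinates
`(x, L = y − x)` as `x⁹L³ + L²(L³+x⁷)² − x²L¹⁴`; dropping the null-space term `x²L¹⁴` and writing `x⁹L³ = (x³L)³`,
`L²(L³+x⁷)² = L^{p−1}F^{p−1}` gives the pattern, which S also fits (`x⁶ + L(L²+x⁵)`). Verified numerically for `p = 2,3,5,7`
before typing. Caveat of record: nothing here bears on L-G4 / (127) (`KangarooShadeIncrease`).

HONEST FRAMING. OURS statements about the OURS bypass objects (bound algebraic `℘`, row 003 U17_2; candidate U17_4 not used);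
nothing here is a statement of H. Hironaka's manuscript [Hironaka2017] (2017-03-23, lit key `paper:url-3343fd9e678b`); no claim
about resolution of singularities in positive characteristic; AI bookkeeping weaker than expert review. All decls `[folklore]`,
sorry-free.
-/

noncomputable section

set_option linter.dupNamespace false -- mandated namespace of this single-conjunct summit

namespace Summit.ResolutionOfSingularities.ResolutionOfSingularities.Theorems.Campaign

open MvPolynomial
open Literature.AlgebraicGeometry.Resolution
open Literature.AlgebraicGeometry.Hironaka2017
open Literature.AlgebraicGeometry.Hironaka2017.S09LLUED (LLChainData)

namespace W13

/-! ## §1 Ring-level scaled-Taylor divisibility for the family (any commutative ring of characteristic `p = k+2`) -/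

section TaylorRing

variable {R : Type*} [CommRing R] (k : ℕ) [hp : Fact (k + 2).Prime] [CharP R (k + 2)]

/-- **Scaled-Taylor divisibility, ring level.** In a commutative ring of characteristic `p = k+2`, with `ξ, λ` («the arc»:
`λ^p + ξ^{2p+1} = 0`), `D` («`θ`»: `D^{p−1}λ^{p−1}ξ^{2p(p−1)} ∈ D^p·R`), `uu = −ξ³λ^{p−2}` («`u`») and free `v₀, w, v₂`:
`D^p` divides `(uu + Dv₂)^p + ((ξ+Dv₀)³(λ+Dw)^{p−2})^p + (λ+Dw)^{p−1}((λ+Dw)^p + (ξ+Dv₀)^{2p+1})^{p−1}` — the value of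
`g_p` at `(x, L, u) = (ξ + Dv₀, λ + Dw, uu + Dv₂)`. Mechanism: freshman's dream for the two `p`-th powers; `F = L^p + x^{2p+1}`
becomes `D·(ξ^{2p}v₀ + D·A₁)` (binomial remainder, `2p+1 ≡ 1`), so `L^{p−1}F^{p−1} ≡ D^{p−1}λ^{p−1}ξ^{2p(p−1)}v₀^{p−1}`
modulo `D^p`. [folklore] -/
theorem surfAllP_ring_dvd (ξ lam D w v₀ v₂ uu r₀ : R)
    (hF0 : lam ^ (k + 2) + ξ ^ (2 * k + 5) = 0) (hu : uu = -(ξ ^ 3 * lam ^ k))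
    (hD : D ^ (k + 1) * (lam ^ (k + 1) * ξ ^ ((2 * k + 4) * (k + 1))) = D ^ (k + 2) * r₀) :
    D ^ (k + 2) ∣ (uu + D * v₂) ^ (k + 2) + ((ξ + D * v₀) ^ 3 * (lam + D * w) ^ k) ^ (k + 2) +
      (lam + D * w) ^ (k + 1) * ((lam + D * w) ^ (k + 2) + (ξ + D * v₀) ^ (2 * k + 5)) ^ (k + 1) := by
  have hchar : ((k + 2 : ℕ) : R) = 0 := CharP.cast_eq_zero R (k + 2)
  -- (1) the `u`-part
  have h1 : (uu + D * v₂) ^ (k + 2) = uu ^ (k + 2) + D ^ (k + 2) * v₂ ^ (k + 2) := by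
    rw [add_pow_char uu (D * v₂) (k + 2), mul_pow]
  -- (2) the `M^p`-part
  have h2 : D ∣ (ξ + D * v₀) ^ 3 * (lam + D * w) ^ k - ξ ^ 3 * lam ^ k := by
    have a : D ∣ (ξ + D * v₀) ^ 3 - ξ ^ 3 :=
      (Dvd.intro v₀ (by ring) : D ∣ (ξ + D * v₀) - ξ).trans (sub_dvd_pow_sub_pow _ _ 3)
    have b : D ∣ (lam + D * w) ^ k - lam ^ k :=
      (Dvd.intro w (by ring) : D ∣ (lam + D * w) - lam).trans (sub_dvd_pow_sub_pow _ _ k)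
    have e : (ξ + D * v₀) ^ 3 * (lam + D * w) ^ k - ξ ^ 3 * lam ^ k =
        ((ξ + D * v₀) ^ 3 - ξ ^ 3) * (lam + D * w) ^ k + ξ ^ 3 * ((lam + D * w) ^ k - lam ^ k) := by ring
    rw [e]
    exact dvd_add (a.mul_right _) (b.mul_left _)
  obtain ⟨m₁, hm₁⟩ := h2
  have h2' : ((ξ + D * v₀) ^ 3 * (lam + D * w) ^ k) ^ (k + 2) =
      (ξ ^ 3 * lam ^ k) ^ (k + 2) + D ^ (k + 2) * m₁ ^ (k + 2) := by
    have e : (ξ + D * v₀) ^ 3 * (lam + D * w) ^ k = ξ ^ 3 * lam ^ k + D * m₁ := by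
      rw [← hm₁]; ring
    rw [e, add_pow_char _ (D * m₁) (k + 2)]
    ring
  -- (3) the arc lies on the hypersurface
  have h3 : uu ^ (k + 2) + (ξ ^ 3 * lam ^ k) ^ (k + 2) = 0 := by
    rw [hu, neg_pow, neg_one_pow_char R (k + 2)]
    ring
  -- (4) `F(γ + Dv) = D·(ξ^{2p} v₀ + D·A₁)`
  obtain ⟨r, hr⟩ := exists_add_pow_succ_eq ξ (D * v₀) (2 * k + 4)
  have hcast : ((2 * k + 4 + 1 : ℕ) : R) = 1 := by
    have e : ((2 * k + 4 + 1 : ℕ) : R) = 2 * ((k + 2 : ℕ) : R) + 1 := by push_cast; ring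
    rw [e, hchar]; ring
  have h4 : (lam + D * w) ^ (k + 2) + (ξ + D * v₀) ^ (2 * k + 5) =
      D * (ξ ^ (2 * k + 4) * v₀ + D * (D ^ k * w ^ (k + 2) + v₀ ^ 2 * r)) := by
    have e5 : 2 * k + 5 = 2 * k + 4 + 1 := by ring
    rw [add_pow_char lam (D * w) (k + 2), e5, hr, hcast]
    rw [e5] at hF0
    linear_combination hF0
  -- (5) first-order expansions of the two `(p−1)`-st powers
  obtain ⟨r₂, hr₂⟩ : ∃ r₂, (ξ ^ (2 * k + 4) * v₀ + D * (D ^ k * w ^ (k + 2) + v₀ ^ 2 * r)) ^ (k + 1) =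
      (ξ ^ (2 * k + 4) * v₀) ^ (k + 1) + D * r₂ := by
    obtain ⟨c, hc⟩ := (Dvd.intro (D ^ k * w ^ (k + 2) + v₀ ^ 2 * r) (by ring) :
      D ∣ (ξ ^ (2 * k + 4) * v₀ + D * (D ^ k * w ^ (k + 2) + v₀ ^ 2 * r)) - ξ ^ (2 * k + 4) * v₀).trans
        (sub_dvd_pow_sub_pow _ _ (k + 1))
    exact ⟨c, by rw [← hc]; ring⟩
  obtain ⟨r₃, hr₃⟩ : ∃ r₃, (lam + D * w) ^ (k + 1) = lam ^ (k + 1) + D * r₃ := by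
    obtain ⟨c, hc⟩ := (Dvd.intro w (by ring) : D ∣ (lam + D * w) - lam).trans (sub_dvd_pow_sub_pow _ _ (k + 1))
    exact ⟨c, by rw [← hc]; ring⟩
  have hA : (ξ ^ (2 * k + 4) * v₀) ^ (k + 1) = ξ ^ ((2 * k + 4) * (k + 1)) * v₀ ^ (k + 1) := by
    rw [mul_pow, ← pow_mul]
  have h4' : ((lam + D * w) ^ (k + 2) + (ξ + D * v₀) ^ (2 * k + 5)) ^ (k + 1) =
      D ^ (k + 1) * (ξ ^ ((2 * k + 4) * (k + 1)) * v₀ ^ (k + 1) + D * r₂) := by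
    rw [h4, mul_pow, hr₂, hA]
  -- (6) assemble
  refine ⟨v₂ ^ (k + 2) + m₁ ^ (k + 2) + (lam ^ (k + 1) * r₂ +
      r₃ * (ξ ^ ((2 * k + 4) * (k + 1)) * v₀ ^ (k + 1) + D * r₂)) + r₀ * v₀ ^ (k + 1), ?_⟩
  rw [h1, h2', h4', hr₃]
  linear_combination h3 + v₀ ^ (k + 1) * hD

end TaylorRing

/-! ## §2 The head `g_p`, the arc `γ(s) = (s^p, s^p − s^{2p+1}, −(s^{3p}(−s^{2p+1})^{p−2}))`, `θ = s^{2p(p²−1)+1}`, and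
## `u^p ∉ ℘_alg(((g_p), p), 1)` — exponent parameter `k`, `p = k + 2` -/

section ArcNumerics

/-- The arc lies on the cusp `L^p = −x^{2p+1}`: `(−s^{2p+1})^p + (s^p)^{2p+1} = 0` in `K[s]`, `char K = p = k+2`. [folklore] -/
theorem surfAllP_cusp (K : Type) [Field K] (k : ℕ) [Fact (k + 2).Prime] [CharP K (k + 2)] :
    (-(Polynomial.X : Polynomial K) ^ (2 * k + 5)) ^ (k + 2) + (Polynomial.X ^ (k + 2)) ^ (2 * k + 5) = 0 := by
  rw [neg_pow, neg_one_pow_char _ (k + 2)]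
  ring

/-- The exponent bookkeeping behind `θ = s^{2p(p²−1)+1}`: `θ^{p−1}·λ^{p−1}·ξ^{2p(p−1)} = θ^p·(±s^{p−2})` for
`ξ = s^p`, `λ = −s^{2p+1}` (`(p−1)(2p²+2p+1) = (2p³−2p+1) + (p−2)`). [folklore] -/
theorem surfAllP_theta (K : Type) [Field K] (k : ℕ) :
    ((Polynomial.X : Polynomial K) ^ (2 * k ^ 3 + 12 * k ^ 2 + 22 * k + 12 + 1)) ^ (k + 1) *
        ((-Polynomial.X ^ (2 * k + 5)) ^ (k + 1) * (Polynomial.X ^ (k + 2)) ^ ((2 * k + 4) * (k + 1))) =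
      (Polynomial.X ^ (2 * k ^ 3 + 12 * k ^ 2 + 22 * k + 12 + 1)) ^ (k + 2) * ((-1) ^ (k + 1) * Polynomial.X ^ k) := by
  rw [neg_pow]
  ring

/-- The tail along the arc: `u(s)^p = (−1)^{(p−1)p}·s^{2p(p²−1)}` for `u = −(ξ³λ^{p−2})`. [folklore] -/
theorem surfAllP_u_pow (K : Type) [Field K] (k : ℕ) :
    (-(((Polynomial.X : Polynomial K) ^ (k + 2)) ^ 3 * (-Polynomial.X ^ (2 * k + 5)) ^ k)) ^ (k + 2) =
      Polynomial.C ((-1 : K) ^ ((k + 1) * (k + 2))) * Polynomial.X ^ (2 * k ^ 3 + 12 * k ^ 2 + 22 * k + 12) := by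
  have e : (-(((Polynomial.X : Polynomial K) ^ (k + 2)) ^ 3 * (-Polynomial.X ^ (2 * k + 5)) ^ k)) =
      (-1) ^ (k + 1) * Polynomial.X ^ (2 * k ^ 2 + 8 * k + 6) := by
    rw [neg_pow]
    ring
  have hC : Polynomial.C ((-1 : K) ^ ((k + 1) * (k + 2))) = (-1 : Polynomial K) ^ ((k + 1) * (k + 2)) := by simp
  rw [e, hC, mul_pow, ← pow_mul, ← pow_mul]
  ring

/-- `θ = s^{N+1}` does not divide `u(s)^p = ±s^N`. [folklore] -/
theorem surfAllP_theta_not_dvd_u_pow (K : Type) [Field K] (k : ℕ) :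
    ¬ (Polynomial.X : Polynomial K) ^ (2 * k ^ 3 + 12 * k ^ 2 + 22 * k + 12 + 1) ∣
      (-(((Polynomial.X : Polynomial K) ^ (k + 2)) ^ 3 * (-Polynomial.X ^ (2 * k + 5)) ^ k)) ^ (k + 2) := by
  rw [surfAllP_u_pow, Polynomial.X_pow_dvd_iff]
  intro h
  have h1 := h (2 * k ^ 3 + 12 * k ^ 2 + 22 * k + 12) (Nat.lt_succ_self _)
  rw [Polynomial.coeff_C_mul_X_pow, if_pos rfl] at h1
  exact pow_ne_zero _ (neg_ne_zero.mpr one_ne_zero) h1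

end ArcNumerics

section Head

variable (K : Type) [Field K] (k : ℕ) [hp : Fact (k + 2).Prime] [CharP K (k + 2)]

/-- **The scaled Taylor certificate for `g_p`**: `C(θ^p) ∣ g_p(γ(s) + θ·v)` in `K[s][v₀,v₁,v₂]` — the ring-level
`surfAllP_ring_dvd` at `ξ = s^p`, `λ = −s^{2p+1}`, `D = θ`, `w = v₁ − v₀`. [folklore] -/
theorem surfAllP_scaled_taylor_dvd :
    (MvPolynomial.C (((Polynomial.X : Polynomial K) ^ (2 * k ^ 3 + 12 * k ^ 2 + 22 * k + 12 + 1)) ^ (k + 2)) :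
        MvPolynomial (Fin 3) (Polynomial K)) ∣
      MvPolynomial.aeval (R := K)
        (fun i => (MvPolynomial.C ((![Polynomial.X ^ (k + 2), Polynomial.X ^ (k + 2) - Polynomial.X ^ (2 * k + 5),
            -((Polynomial.X ^ (k + 2)) ^ 3 * (-Polynomial.X ^ (2 * k + 5)) ^ k)] : Fin 3 → Polynomial K) i) :
            MvPolynomial (Fin 3) (Polynomial K)) +
          MvPolynomial.C (Polynomial.X ^ (2 * k ^ 3 + 12 * k ^ 2 + 22 * k + 12 + 1)) * X i)
        (X 2 ^ (k + 2) + ((X 0 ^ 3 * (X 1 - X 0) ^ k) ^ (k + 2) +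
          (X 1 - X 0) ^ (k + 1) * ((X 1 - X 0) ^ (k + 2) + X 0 ^ (2 * k + 5)) ^ (k + 1)) : MvPolynomial (Fin 3) K) := by
  have haeval : MvPolynomial.aeval (R := K)
        (fun i => (MvPolynomial.C ((![Polynomial.X ^ (k + 2), Polynomial.X ^ (k + 2) - Polynomial.X ^ (2 * k + 5),
            -((Polynomial.X ^ (k + 2)) ^ 3 * (-Polynomial.X ^ (2 * k + 5)) ^ k)] : Fin 3 → Polynomial K) i) :
            MvPolynomial (Fin 3) (Polynomial K)) +
          MvPolynomial.C (Polynomial.X ^ (2 * k ^ 3 + 12 * k ^ 2 + 22 * k + 12 + 1)) * X i)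
        (X 2 ^ (k + 2) + ((X 0 ^ 3 * (X 1 - X 0) ^ k) ^ (k + 2) +
          (X 1 - X 0) ^ (k + 1) * ((X 1 - X 0) ^ (k + 2) + X 0 ^ (2 * k + 5)) ^ (k + 1)) : MvPolynomial (Fin 3) K) =
      (MvPolynomial.C (-(((Polynomial.X : Polynomial K) ^ (k + 2)) ^ 3 * (-Polynomial.X ^ (2 * k + 5)) ^ k)) +
          MvPolynomial.C (Polynomial.X ^ (2 * k ^ 3 + 12 * k ^ 2 + 22 * k + 12 + 1)) * X 2) ^ (k + 2) +
        ((MvPolynomial.C (Polynomial.X ^ (k + 2)) +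
            MvPolynomial.C (Polynomial.X ^ (2 * k ^ 3 + 12 * k ^ 2 + 22 * k + 12 + 1)) * X 0) ^ 3 *
          (MvPolynomial.C (-(Polynomial.X : Polynomial K) ^ (2 * k + 5)) +
            MvPolynomial.C (Polynomial.X ^ (2 * k ^ 3 + 12 * k ^ 2 + 22 * k + 12 + 1)) * (X 1 - X 0)) ^ k) ^ (k + 2) +
        (MvPolynomial.C (-(Polynomial.X : Polynomial K) ^ (2 * k + 5)) +
            MvPolynomial.C (Polynomial.X ^ (2 * k ^ 3 + 12 * k ^ 2 + 22 * k + 12 + 1)) * (X 1 - X 0)) ^ (k + 1) *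
          ((MvPolynomial.C (-(Polynomial.X : Polynomial K) ^ (2 * k + 5)) +
              MvPolynomial.C (Polynomial.X ^ (2 * k ^ 3 + 12 * k ^ 2 + 22 * k + 12 + 1)) * (X 1 - X 0)) ^ (k + 2) +
            (MvPolynomial.C (Polynomial.X ^ (k + 2)) +
              MvPolynomial.C (Polynomial.X ^ (2 * k ^ 3 + 12 * k ^ 2 + 22 * k + 12 + 1)) * X 0) ^ (2 * k + 5)) ^ (k + 1) := by
    simp only [map_add, map_sub, map_neg, map_mul, map_pow, MvPolynomial.aeval_X, Matrix.cons_val_zero,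
      Matrix.cons_val_one, Matrix.cons_val_two, Matrix.tail_cons, Matrix.head_cons]
    ring
  have hF0 : (MvPolynomial.C (-(Polynomial.X : Polynomial K) ^ (2 * k + 5)) : MvPolynomial (Fin 3) (Polynomial K)) ^
        (k + 2) + MvPolynomial.C (Polynomial.X ^ (k + 2)) ^ (2 * k + 5) = 0 := by
    rw [← map_pow, ← map_pow, ← map_add, surfAllP_cusp, map_zero]
  have hD : (MvPolynomial.C (Polynomial.X ^ (2 * k ^ 3 + 12 * k ^ 2 + 22 * k + 12 + 1)) :
        MvPolynomial (Fin 3) (Polynomial K)) ^ (k + 1) *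
        (MvPolynomial.C (-(Polynomial.X : Polynomial K) ^ (2 * k + 5)) ^ (k + 1) *
          MvPolynomial.C (Polynomial.X ^ (k + 2)) ^ ((2 * k + 4) * (k + 1))) =
      MvPolynomial.C (Polynomial.X ^ (2 * k ^ 3 + 12 * k ^ 2 + 22 * k + 12 + 1)) ^ (k + 2) *
        MvPolynomial.C ((-1) ^ (k + 1) * Polynomial.X ^ k) := by
    rw [← map_pow, ← map_pow, ← map_pow, ← map_mul, ← map_mul, ← map_pow, ← map_mul, surfAllP_theta]
  rw [haeval, map_pow]
  exact surfAllP_ring_dvd k _ _ _ (X 1 - X 0) (X 0) (X 2) _ _ hF0 (by simp only [map_neg, map_mul, map_pow]) hD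

/-- **`u^p ∉ ℘_alg(((g_p), p), 1)`** for every prime `p = k+2` and every field `K` of characteristic `p` (bound algebraic
`℘`, row 003 U17_2): the scaled-Taylor arc criterion (`not_mem_pAlgPiece_one_of_scaled_taylor`) along
`γ(s) = (s^p, s^p − s^{2p+1}, u(s))`, `θ = s^{2p(p²−1)+1}`, with `θ ∤ u^p = ±s^{2p(p²−1)}`. [folklore] -/
theorem surfAllP_tail_pow_not_mem :
    (X 2 : MvPolynomial (Fin 3) K) ^ (k + 2) ∉
      Campaign.pAlgPiece K (Ideal.span {(X 2 ^ (k + 2) + ((X 0 ^ 3 * (X 1 - X 0) ^ k) ^ (k + 2) +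
        (X 1 - X 0) ^ (k + 1) * ((X 1 - X 0) ^ (k + 2) + X 0 ^ (2 * k + 5)) ^ (k + 1)) : MvPolynomial (Fin 3) K)})
        (k + 2) 1 := by
  classical
  refine not_mem_pAlgPiece_one_of_scaled_taylor K
    (![Polynomial.X ^ (k + 2), Polynomial.X ^ (k + 2) - Polynomial.X ^ (2 * k + 5),
      -((Polynomial.X ^ (k + 2)) ^ 3 * (-Polynomial.X ^ (2 * k + 5)) ^ k)] : Fin 3 → Polynomial K)
    (θ := (Polynomial.X : Polynomial K) ^ (2 * k ^ 3 + 12 * k ^ 2 + 22 * k + 12 + 1))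
    (pow_ne_zero _ Polynomial.X_ne_zero) _ (k + 2) (surfAllP_scaled_taylor_dvd K k) ?_
  simp only [map_pow, MvPolynomial.aeval_X, Matrix.cons_val_two, Matrix.tail_cons, Matrix.head_cons]
  exact surfAllP_theta_not_dvd_u_pow K k

/-- **Stalk-level form**: `s·u^p ∉ ℘_alg(((g_p),p),1)` whenever `s(0) ≠ 0` (the arc passes through the origin). [folklore] -/
theorem surfAllP_mul_tail_pow_not_mem (s : MvPolynomial (Fin 3) K) (hs : coeff 0 s ≠ 0) :
    s * X 2 ^ (k + 2) ∉
      Campaign.pAlgPiece K (Ideal.span {(X 2 ^ (k + 2) + ((X 0 ^ 3 * (X 1 - X 0) ^ k) ^ (k + 2) +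
        (X 1 - X 0) ^ (k + 1) * ((X 1 - X 0) ^ (k + 2) + X 0 ^ (2 * k + 5)) ^ (k + 1)) : MvPolynomial (Fin 3) K)})
        (k + 2) 1 := by
  classical
  have hf : ∀ i, ((![Polynomial.X ^ (k + 2), Polynomial.X ^ (k + 2) - Polynomial.X ^ (2 * k + 5),
      -((Polynomial.X ^ (k + 2)) ^ 3 * (-Polynomial.X ^ (2 * k + 5)) ^ k)] : Fin 3 → Polynomial K) i).coeff 0 = 0 := by
    intro i
    fin_cases i <;> simp [Polynomial.coeff_zero_eq_eval_zero]
  refine not_mem_pAlgPiece_one_of_scaled_taylor K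
    (![Polynomial.X ^ (k + 2), Polynomial.X ^ (k + 2) - Polynomial.X ^ (2 * k + 5),
      -((Polynomial.X ^ (k + 2)) ^ 3 * (-Polynomial.X ^ (2 * k + 5)) ^ k)] : Fin 3 → Polynomial K)
    (θ := (Polynomial.X : Polynomial K) ^ (2 * k ^ 3 + 12 * k ^ 2 + 22 * k + 12 + 1))
    (pow_ne_zero _ Polynomial.X_ne_zero) _ (k + 2) (surfAllP_scaled_taylor_dvd K k) ?_
  simp only [map_mul, map_pow, MvPolynomial.aeval_X, Matrix.cons_val_two, Matrix.tail_cons, Matrix.head_cons]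
  rw [surfAllP_u_pow, ← mul_assoc, Polynomial.X_pow_dvd_iff]
  intro h
  have h1 := h (2 * k ^ 3 + 12 * k ^ 2 + 22 * k + 12) (Nat.lt_succ_self _)
  rw [Polynomial.coeff_mul_X_pow', if_pos le_rfl, Nat.sub_self, Polynomial.coeff_mul_C] at h1
  have h0 := coeff_zero_aeval_of_coeff_zero K _ hf s
  rcases mul_eq_zero.mp h1 with h2 | h2
  · rw [h2] at h0
    exact hs h0.symm
  · exact pow_ne_zero _ (neg_ne_zero.mpr one_ne_zero) h2

end Head

end W13

end Summit.ResolutionOfSingularities.ResolutionOfSingularities.Theorems.Campaign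

end
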